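import Literature.IUT.HodgeArakelov.EtaleThetaDataSignTransport
import Literature.IUT.HodgeArakelov.CohomologyAutFunctorialityComp
import Literature.IUT.HodgeArakelov.CohomologyAutCoeffChange
import Mathlib.GroupTheory.OrderOfElement

/-!
# The §2 transport at the model, ι-shape: `hroot` ("`ι` carries the `l`-th root class `η̲̈^Θ` to a
# `Π^tp_Y̲̲`-conjugate") from the `Δ_Θ`-level statement about `η̈^Θ`

Mochizuki, *The étale theta function …*, Publ. RIMS **45** (2009): Prop. 1.4 (ii) p. 22 ("`Θ̈(Ü) = −Θ̈(Ü⁻¹)`"),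
Prop. 2.2 (i) p. 37 ("[`ι`] acts on [`Δ̄_Θ`] by `+1`"), Def. 2.7 p. 41 (the `l`-th root `η̲̈^Θ`, "up to
multiplication by a root of unity of order `l`") [cite: MochizukiEtTh2009, Def 2.7 p.41]; consumer: [IUTchII]
Prop. 2.2 (ii) at the model, `Literature.IUT.HodgeArakelov.prop22_ii'_model` (abc-iut-w4-d010, p414140), binder
(R2) `hroot` [cite: Mochizuki2012, Prop 2.2 (ii) p.66].

PROOF-ONLY companion (no definitions; cell abc-iut, seat abc-iut-L2-t8; GAP row G-w4d010-2, "§2 transport",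
ι-shape) to `EtaleThetaDataSignTransport.lean` (this seat) over abc-iut-L6-t1's `CohomologyAutFunctoriality*.lean`
(`ContH1Aut.autMap`, `h1TopAut`). Generic part (namespace `ContH1Aut`, automorphism pair `(α, β)`; the naturality `coeffChange_autMap` and the
inner case `autMap_eq_conj_of_inner` are abc-iut-w4-d014's `CohomologyAutCoeffChange.lean`, p415311, imported):
* `autMap_eq_self_of_coeffChange_eq_one` — if `β` acts TRIVIALLY on `A'/A` (`β a' ∈ A·a'`; weaker than
  p415311's `autMap_eq_of_coeffChange_eq_one`, which needs `β = id` on `A'`), the transport fixes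
  `Ker(H¹(H, A) → H¹(H, A'))` pointwise.
Model part (namespace `EtaleThetaDataOfSetting`, `Π := Π^tp_X̲̲`, `T := h1TopAut …` the transport along the
pointed-inversion pair `(α, β)` of abc-iut-w4-d010's (R1)):
* `h1TopAut_h1TopAut_eq_conj` — if `α² = conj δ` (`ι` is an involution of `X̲̲` up to an inner automorphism:
  `PointedInversion.iota_sq_inner`), then `T ∘ T = conj δ` on `H¹(Π_Ÿ(Π), l·Δ_Θ)` (`β²` is forced to be
  `conj φ(δ)` on `l·Δ_Θ ⊆ φ(Π^tp_X̲̲)`);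
* **`hroot_of_coeffChange_root`** — (R2) ι-shape: if `β` acts by `+1` on `Δ_Θ/l·Δ_Θ` (Prop. 2.2 (i)), `α² = conj δ`,
  and the `Δ_Θ`-IMAGE of `T η̲̈^Θ` is the `τ₀`-conjugate of the `Δ_Θ`-image of `η̲̈^Θ` for some `τ₀ ∈ Π^tp_Y̲̲`
  (the class-level "`Θ̈(Ü) = −Θ̈(Ü⁻¹)`" for `η̈^Θ`, pulled back — a HYPOTHESIS here), then `T η̲̈^Θ = τ₀·η̲̈^Θ`
  EXACTLY, given `hsign` and the non-torsion of the `γ`-translates (the `μ_l`-ambiguity `ν` satisfies `Tν = ν`,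
  `conj ν = ν`, `ν^l = 1`, and `T∘T = conj δ` forces `ν² ∈ {1, κ}` with `κ² = 1`, so `ν⁴ = 1 = ν^l`, `ν = 1`).
Honest framing: all `Δ_Θ`-level inputs and the pair `(α, β)` are hypotheses; [EtTh] is refereed; the consumer's
claim key `Mochizuki2012` is disputed (D-0012); nothing here bears on [IUTchIII] Cor. 3.12. typed ≠ proved.
-/

namespace Literature.IUT.HodgeArakelov

open Literature.AnabelianGeometry.EtaleTheta (ContH1 contCocycles)
open Literature.AnabelianGeometry.EtaleTheta
open CohomologySystemOfContH1

universe u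

noncomputable section

/-! ## Generic: transport along an automorphism pair vs. change of coefficients / inner pairs -/

namespace ContH1Aut

variable {G : Type u} {G' : Type u} [Group G] [TopologicalSpace G]
  [Group G'] [TopologicalSpace G'] [IsTopologicalGroup G']
  (φ : G →* G') {A A' : Subgroup G'} [A.Normal] [IsMulCommutative A] [A'.Normal] [IsMulCommutative A']
  (hAA' : A ≤ A')

/-- Group identity behind `autMap (∂a') ∼ ∂a'` when `β a' = c·a'`, `c ∈ A`:
`(u a u⁻¹ a⁻¹)⁻¹ (u (c a) u⁻¹ (c a)⁻¹) = u c u⁻¹ c⁻¹` when `c`, `u c u⁻¹` commute with `a`. [folklore] -/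
private theorem coboundary_shift_aux {K : Type*} [Group K] (u a c : K) (h1 : Commute c a)
    (h2 : Commute (u * c * u⁻¹) a) :
    (u * a * u⁻¹ * a⁻¹)⁻¹ * (u * (c * a) * u⁻¹ * (c * a)⁻¹) = u * c * u⁻¹ * c⁻¹ := by
  have e1 : a⁻¹ * (c * a) = c := by rw [h1.eq, inv_mul_cancel_left]
  have e2 : a * (u * c * u⁻¹) * a⁻¹ = u * c * u⁻¹ := by rw [← h2.eq, mul_inv_cancel_right]
  calc (u * a * u⁻¹ * a⁻¹)⁻¹ * (u * (c * a) * u⁻¹ * (c * a)⁻¹)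
      = a * (u * (a⁻¹ * (c * a)) * u⁻¹) * a⁻¹ * c⁻¹ := by group
    _ = a * (u * c * u⁻¹) * a⁻¹ * c⁻¹ := by rw [e1]
    _ = u * c * u⁻¹ * c⁻¹ := by rw [e2]

/-- **A pair acting trivially on `A'/A` fixes `Ker(H¹(H, A) → H¹(H, A'))` pointwise.** If for every `a' ∈ A'`
one has `β a' = c·a'` with `c ∈ A` (in [EtTh]: `ι` acts by `+1` on `Δ̄_Θ = Δ_Θ/l·Δ_Θ`, Prop. 2.2 (i) p. 37), then
`autMap (α, β)` fixes the class of every `A`-valued `A'`-coboundary `∂a'` — it is carried to `∂(β a') = ∂a'·∂c`,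
and `∂c` is an `A`-coboundary. [cite: NeukirchSchmidtWingberg2008, I §5] -/
theorem autMap_eq_self_of_coeffChange_eq_one [IsTopologicalGroup G] (α : G ≃ₜ* G) (β : G' ≃ₜ* G')
    (hφ : ∀ g, β (φ g) = φ (α g)) (hA : ∀ a : G', a ∈ A → β a ∈ A)
    {H : Subgroup G} (hH : ∀ x, x ∈ H → α.symm x ∈ H)
    (hβ : ∀ a' : A', ∃ c : A, (β a' : G') = (c : G') * a')
    (x : ContH1 φ A H) (hx : ContH1.coeffChange φ hAA' H x = 1) : autMap φ A α β hφ hA hH x = x := by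
  induction x using QuotientGroup.induction_on with
  | H f =>
    have hmem : ContH1.coeffCocycle φ hAA' H f ∈
        (contCoboundaries φ A' H).subgroupOf (contCocycles φ A' H) :=
      (QuotientGroup.eq_one_iff _).mp hx
    obtain ⟨a', ha'⟩ := (mem_contCoboundaries_iff _).mp (Subgroup.mem_subgroupOf.mp hmem)
    have hval : ∀ k : H, ((f.1 k : A) : G') = φ (k : G) * a' * (φ (k : G))⁻¹ * (a' : G')⁻¹ := by
      intro k
      have := congrArg (fun b : A' => (b : G')) (congrFun ha' k)
      simpa [MulAut.conjNormal_apply] using this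
    obtain ⟨c, hc⟩ := hβ a'
    symm
    change (QuotientGroup.mk f : contCocycles φ A H ⧸ (contCoboundaries φ A H).subgroupOf (contCocycles φ A H)) =
      QuotientGroup.mk (autCocycle φ A α β hφ hA hH f)
    rw [QuotientGroup.eq, Subgroup.mem_subgroupOf, mem_contCoboundaries_iff]
    refine ⟨c, ?_⟩
    funext h
    apply Subtype.ext
    change ((f.1 h : A) : G')⁻¹ * ((autCocycle φ A α β hφ hA hH f).1 h : G') = _
    rw [coe_autCocycle_apply, hval, hval, Subgroup.coe_mul, Subgroup.coe_inv, MulAut.conjNormal_apply]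
    simp only [map_mul, map_inv, hφ, ContinuousMulEquiv.apply_symm_apply]
    rw [hc]
    have h1 : Commute (c : G') (a' : G') := by
      have := IsMulCommutative.is_comm.comm (Subgroup.inclusion hAA' c) a'
      exact congrArg Subtype.val this
    have h2 : Commute (φ (h : G) * c * (φ (h : G))⁻¹) (a' : G') := by
      have hm : φ (h : G) * c * (φ (h : G))⁻¹ ∈ A' := hAA' (by
        simpa [MulAut.conjNormal_apply] using (MulAut.conjNormal (φ (h : G)) c).2)
      have := IsMulCommutative.is_comm.comm (⟨_, hm⟩ : A') a'
      exact congrArg Subtype.val this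
    exact coboundary_shift_aux (φ (h : G)) (a' : G') (c : G') h1 h2

end ContH1Aut

/-! ## At the model `Π := Π^tp_X̲̲` -/

namespace EtaleThetaDataOfSetting

variable {p : ℕ} [Fact p.Prime] {D : Literature.AnabelianGeometry.EtaleTheta.ThetaSetting p}
  {E : D.EtaleThetaData} {l : ℕ} (C : E.DoubleUnderline l) [hN : (PiYdd C).Normal]

omit hN in
/-- `l·Δ_Θ ⊆ φ(Π^tp_X̲̲)` ("`Ker(Δ^Θ_* ↠ Δ^ell_*) = l·Δ_Θ`", Prop. 2.12 (i) p. 45 — abc-iut-L2-t8's field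
`map_toTheta_Huu`). [cite: MochizukiEtTh2009, Prop 2.12 (i) p.45] -/
theorem lDeltaTheta_le_map_toTheta_Huu : D.lDeltaTheta l ≤ C.Huu.map D.toTheta := by
  rw [← C.map_toTheta_Huu]
  exact inf_le_left

omit hN in
/-- Every element of `Π^tp_X̲̲` is `γⁿ·y` with `y ∈ Π^tp_Y̲̲ = Ker(toLZ)` (`toLZ : Π^tp_X̲̲ ↠ ℤ`, `toLZ γ = 1`).
[cite: MochizukiEtTh2009, Def 2.13 (i) p.47] -/
theorem exists_eq_zpow_mul_of_toLZ (γ : Pi C) (hγ : C.toLZ γ = Multiplicative.ofAdd 1) (w : Pi C) :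
    ∃ (n : ℤ) (y : Pi C), (y : D.PiTemp) ∈ D.GtpY ∧ w = γ ^ n * y := by
  refine ⟨Multiplicative.toAdd (C.toLZ w), (γ ^ Multiplicative.toAdd (C.toLZ w))⁻¹ * w, ?_,
    (mul_inv_cancel_left _ _).symm⟩
  have hker : (γ ^ Multiplicative.toAdd (C.toLZ w))⁻¹ * w ∈ C.toLZ.ker := by
    rw [MonoidHom.mem_ker, map_mul, map_inv, map_zpow, hγ, ← ofAdd_zsmul, smul_eq_mul, mul_one,
      ofAdd_toAdd, inv_mul_cancel]
  rw [C.toLZ_ker, Subgroup.mem_subgroupOf] at hker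
  exact hker

/-- Sharpening of abc-iut-w4-d010's `conj_rootLiftClass_of_mem_GtpY`: an element `y ∈ Π^tp_Y̲̲` moves the root
class by a class `t` with `t² = 1` (either `y ∈ Π^tp_Ÿ̲̲` acts trivially, or `y ∈ ε·Π^tp_Ÿ̲̲` and `t = κ` from
`hsign`). [cite: MochizukiEtTh2009, Def 2.7 p.41] -/
theorem exists_sq_eq_one_conj_rootLiftClass_of_mem_GtpY (hS : D.Sec2Hyps) (ε : Pi C)
    (hε₁ : (ε : D.PiTemp) ∈ D.GtpY) (hε₂ : (ε : D.PiTemp) ∉ D.GtpYdd)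
    (hsign : ∃ κ : ContH1 (phi C) (D.lDeltaTheta l) (PiYdd C ⊓ ⊤), κ ^ 2 = 1 ∧
      ContH1.conj (phi C) (D.lDeltaTheta l) ε (rootLiftClass C) = rootLiftClass C * κ)
    (y : Pi C) (hy : (y : D.PiTemp) ∈ D.GtpY) :
    ∃ t : ContH1 (phi C) (D.lDeltaTheta l) (PiYdd C ⊓ ⊤), t ^ 2 = 1 ∧
      ContH1.conj (phi C) (D.lDeltaTheta l) y (rootLiftClass C) = rootLiftClass C * t := by
  by_cases hyYdd : (y : D.PiTemp) ∈ D.GtpYdd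
  · refine ⟨1, one_pow 2, ?_⟩
    rw [mul_one]
    exact ContH1.conj_eq_self_of_mem _ (Subgroup.mem_inf.mpr
      ⟨Subgroup.mem_subgroupOf.mpr (Subgroup.mem_inf.mpr ⟨hyYdd, y.2⟩), Subgroup.mem_top _⟩) _
  · obtain ⟨κ, hκ2, hκ⟩ := hsign
    have h2 : (D.GtpYdd.subgroupOf (C.Huu ⊓ D.GtpY)).index = 2 := C.relIndex_GtpYdd_inf hS
    let aε : ↥(C.Huu ⊓ D.GtpY) := ⟨(ε : D.PiTemp), Subgroup.mem_inf.mpr ⟨ε.2, hε₁⟩⟩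
    let ay : ↥(C.Huu ⊓ D.GtpY) := ⟨(y : D.PiTemp), Subgroup.mem_inf.mpr ⟨y.2, hy⟩⟩
    have hprod : aε⁻¹ * ay ∈ D.GtpYdd.subgroupOf (C.Huu ⊓ D.GtpY) := by
      rw [Subgroup.mul_mem_iff_of_index_two h2, inv_mem_iff, Subgroup.mem_subgroupOf,
        Subgroup.mem_subgroupOf]
      exact ⟨fun h => absurd h hε₂, fun h => absurd h hyYdd⟩
    rw [Subgroup.mem_subgroupOf] at hprod
    have hy' : ε⁻¹ * y ∈ PiYdd C ⊓ ⊤ :=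
      Subgroup.mem_inf.mpr ⟨Subgroup.mem_subgroupOf.mpr (Subgroup.mem_inf.mpr ⟨hprod, (ε⁻¹ * y).2⟩),
        Subgroup.mem_top _⟩
    refine ⟨κ, hκ2, ?_⟩
    have hyε : y = ε * (ε⁻¹ * y) := (mul_inv_cancel_left ε y).symm
    conv_lhs => rw [hyε, ContH1.conj_mul_apply, ContH1.conj_eq_self_of_mem _ hy']
    exact hκ

/-- In a monoid, an element with `x² = 1` equals its odd powers. [folklore] -/
private theorem pow_eq_self_of_sq_eq_one {M : Type*} [Monoid M] {x : M} {n : ℕ} (hn : Odd n)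
    (h2 : x ^ 2 = 1) : x ^ n = x := by
  obtain ⟨k, rfl⟩ := hn
  rw [pow_succ, pow_mul, h2, one_pow, one_mul]

/-- In a monoid, `x⁴ = 1` and `xⁿ = 1` with `n` odd force `x = 1`. [folklore] -/
private theorem eq_one_of_pow_four_of_pow_odd {M : Type*} [Monoid M] {x : M} {n : ℕ} (hn : Odd n)
    (h4 : x ^ 4 = 1) (hn1 : x ^ n = 1) : x = 1 := by
  have h2 : x ^ 2 = 1 := by
    have hy2 : (x ^ 2) ^ 2 = 1 := by rw [← pow_mul]; exact h4
    have hyn : (x ^ 2) ^ n = 1 := by rw [← pow_mul, mul_comm, pow_mul, hn1, one_pow]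
    rw [← pow_eq_self_of_sq_eq_one hn hy2]
    exact hyn
  rw [← pow_eq_self_of_sq_eq_one hn h2]
  exact hn1

section Pair

variable (α : (Pi C) ≃ₜ* (Pi C)) (β : D.GtpTheta ≃ₜ* D.GtpTheta) (hφ : ∀ g, β (phi C g) = phi C (α g))
  (hA : ∀ a : D.GtpTheta, a ∈ D.lDeltaTheta l → β a ∈ D.lDeltaTheta l)
  (hH : ∀ x, x ∈ PiYdd C ↔ α x ∈ PiYdd C)

omit hN in
/-- Unfolding: the transport `h1TopAut` on `H¹(Π_Ÿ(Π) ∩ ⊤, ·)` IS `ContH1Aut.autMap` along `(α, β)`.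
[cite: Mochizuki2012, Cor 1.12 (i) p.57] -/
theorem h1TopAut_apply {A : Subgroup D.GtpTheta} [A.Normal] [IsMulCommutative A]
    (hA₀ : ∀ a : D.GtpTheta, a ∈ A → β a ∈ A) (x : ContH1 (phi C) A (PiYdd C ⊓ ⊤)) :
    h1TopAut (phi C) A (PiYdd C) α β hφ hA₀ hH x =
      ContH1Aut.autMap (phi C) A α β hφ hA₀ (symm_mem_inf_top (PiYdd C) α hH) x := rfl

/-- **`T ∘ T = conj δ` on `H¹(Π_Ÿ(Π), l·Δ_Θ)`** for the transport `T := h1TopAut` along a pair `(α, β)` with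
`α² = conj δ` (`ι²` is inner: `PointedInversion.iota_sq_inner`): `β²` agrees with `conj φ(δ)` on
`l·Δ_Θ ⊆ φ(Π^tp_X̲̲)` by the compatibility `β ∘ φ = φ ∘ α`, so the composite pair is inner on the relevant data
(`ContH1Aut.autMap_trans`, `autMap_eq_conj_of_inner`). [cite: Mochizuki2012, Prop 2.2 (ii) p.66] -/
theorem h1TopAut_h1TopAut_eq_conj (δ : Pi C) (hαα : ∀ x : Pi C, α (α x) = δ * x * δ⁻¹)
    (x : ContH1 (phi C) (D.lDeltaTheta l) (PiYdd C ⊓ ⊤)) :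
    h1TopAut (phi C) (D.lDeltaTheta l) (PiYdd C) α β hφ hA hH
        (h1TopAut (phi C) (D.lDeltaTheta l) (PiYdd C) α β hφ hA hH x) =
      ContH1.conj (phi C) (D.lDeltaTheta l) δ x := by
  have hφ₂ : ∀ g, (β.trans β) (phi C g) = phi C ((α.trans α) g) := fun g => by
    change β (β (phi C g)) = phi C (α (α g))
    rw [hφ, hφ]
  have hA₂ : ∀ a : D.GtpTheta, a ∈ D.lDeltaTheta l → (β.trans β) a ∈ D.lDeltaTheta l :=
    fun a ha => hA _ (hA a ha)
  have hH₁ := symm_mem_inf_top (PiYdd C) α hH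
  have hH₂ : ∀ x, x ∈ PiYdd C ⊓ ⊤ → (α.trans α).symm x ∈ PiYdd C ⊓ ⊤ :=
    fun x hx => hH₁ _ (hH₁ x hx)
  rw [h1TopAut_apply, h1TopAut_apply,
    ContH1Aut.autMap_trans (phi C) (D.lDeltaTheta l) α α β β hφ hφ hφ₂ hA hA hA₂ hH₁ hH₁ hH₂ x]
  refine ContH1Aut.autMap_eq_conj_of_inner (phi C) (A := D.lDeltaTheta l) (α.trans α) (β.trans β)
    hφ₂ hA₂ hH₂ δ (fun y => hαα y) (fun a ha => ?_) x
  obtain ⟨h, hh, hha⟩ := lDeltaTheta_le_map_toTheta_Huu C ha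
  have hga : phi C ⟨h, hh⟩ = a := hha
  change β (β a) = _
  rw [← hga, hφ, hφ, hαα, map_mul, map_mul, map_inv]

/-- **(R2), ι-shape: `hroot` from the `Δ_Θ` level.** Let `(α, β)` be the pointed-inversion pair with
`α² = conj δ` (`ι` an involution of `X̲̲` up to inner automorphisms) and `β` acting by `+1` on
`Δ̄_Θ = Δ_Θ/l·Δ_Θ` ([EtTh] Prop. 2.2 (i) p. 37), `T := h1TopAut` its transport on `H¹(Π_Ÿ(Π), l·Δ_Θ)`; assume
`hsign` (the sign of `ε`, (R2)) and the non-torsion of the `γ`-translates of `η̲̈^Θ` ((R3) input of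
`hfree_of_translate_not_isOfFinOrder`). IF the `Δ_Θ`-image of `T η̲̈^Θ` is the `τ₀`-conjugate of the `Δ_Θ`-image of
`η̲̈^Θ` for some `τ₀ ∈ Π^tp_Y̲̲` — [EtTh] Prop. 1.4 (ii) "`Θ̈(Ü) = −Θ̈(Ü⁻¹)`" for `η̈^Θ` AT THE CLASS LEVEL, pulled back to
`Π_Ÿ(Π)`; a HYPOTHESIS here — THEN `T η̲̈^Θ = τ₀·η̲̈^Θ` EXACTLY (binder `hroot` of `prop22_ii'_model`). PROOF: the
ambiguity `ν := T η̲̈ / τ₀·η̲̈` lies in `Ker(H¹(l·Δ_Θ) → H¹(Δ_Θ))`, so `ν^l = 1`, `Tν = ν`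
(`autMap_eq_self_of_coeffChange_eq_one`) and `σ·ν = ν` for all `σ` (`conj_eq_self_of_coeffChange_eq_one`);
`T(T η̲̈) = δ·η̲̈` gives `((ατ₀)τ₀)⁻¹δ · η̲̈ = η̲̈·ν²`; writing `((ατ₀)τ₀)⁻¹δ = γⁿ·y` (`y ∈ Π^tp_Y̲̲`), the translate
`γⁿ·η̲̈/η̲̈` is torsion, so `n = 0` and `ν² = t` with `t² = 1`; hence `ν⁴ = 1 = ν^l`, `ν = 1` (`l` odd).
[cite: MochizukiEtTh2009, Prop 1.4 (ii) p.22] -/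
theorem hroot_of_coeffChange_root (hS : D.Sec2Hyps) (γ ε : Pi C) (hγ : C.toLZ γ = Multiplicative.ofAdd 1)
    (hε₁ : (ε : D.PiTemp) ∈ D.GtpY) (hε₂ : (ε : D.PiTemp) ∉ D.GtpYdd)
    (hsign : ∃ κ : ContH1 (phi C) (D.lDeltaTheta l) (PiYdd C ⊓ ⊤), κ ^ 2 = 1 ∧
      ContH1.conj (phi C) (D.lDeltaTheta l) ε (rootLiftClass C) = rootLiftClass C * κ)
    (hfreeK : ∀ k : ℤ, k ≠ 0 → ¬ IsOfFinOrder
      (ContH1.conj (phi C) (D.lDeltaTheta l) (γ ^ k) (rootLiftClass C) * (rootLiftClass C)⁻¹))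
    (δ : Pi C) (hαα : ∀ x : Pi C, α (α x) = δ * x * δ⁻¹)
    (hβ : ∀ a : D.GtpTheta, a ∈ D.DeltaTheta → β a * a⁻¹ ∈ D.lDeltaTheta l)
    (h : ∃ τ₀ : Pi C, (τ₀ : D.PiTemp) ∈ D.GtpY ∧
      ContH1.coeffChange (phi C) (D.lDeltaTheta_le l) (PiYdd C ⊓ ⊤)
          (h1TopAut (phi C) (D.lDeltaTheta l) (PiYdd C) α β hφ hA hH (rootLiftClass C)) =
        ContH1.conj (phi C) D.DeltaTheta τ₀
          (ContH1.coeffChange (phi C) (D.lDeltaTheta_le l) (PiYdd C ⊓ ⊤) (rootLiftClass C))) :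
    ∃ τ₀ : Pi C, (τ₀ : D.PiTemp) ∈ D.GtpY ∧
      h1TopAut (phi C) (D.lDeltaTheta l) (PiYdd C) α β hφ hA hH (rootLiftClass C) =
        ContH1.conj (phi C) (D.lDeltaTheta l) τ₀ (rootLiftClass C) := by
  obtain ⟨τ₀, hτ₀Y, hcc⟩ := h
  refine ⟨τ₀, hτ₀Y, ?_⟩
  -- abbreviations: `T`, `η`, and the ambiguity `ν := T η / τ₀·η`
  set T := h1TopAut (phi C) (D.lDeltaTheta l) (PiYdd C) α β hφ hA hH with hT
  set η := rootLiftClass C with hη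
  set ν := T η / ContH1.conj (phi C) (D.lDeltaTheta l) τ₀ η with hν
  have hTη : T η = ContH1.conj (phi C) (D.lDeltaTheta l) τ₀ η * ν := by
    rw [hν, mul_div_cancel]
  -- `ν` lies in the kernel of the change of coefficients: `ν^l = 1`, `σ·ν = ν`, `T ν = ν`
  have hν_cc : ContH1.coeffChange (phi C) (D.lDeltaTheta_le l) (PiYdd C ⊓ ⊤) ν = 1 := by
    rw [hν, map_div, hcc, ← ContH1.conj_coeffChange, div_self']
  have hν_l : ν ^ l = 1 := pow_l_eq_one_of_coeffChange_eq_one C ⊤ _ hν_cc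
  have hν_conj : ∀ σ : Pi C, ContH1.conj (phi C) (D.lDeltaTheta l) σ ν = ν :=
    fun σ => conj_eq_self_of_coeffChange_eq_one C σ _ hν_cc
  have hβ' : ∀ a' : D.DeltaTheta, ∃ c : D.lDeltaTheta l, (β a' : D.GtpTheta) = (c : D.GtpTheta) * a' :=
    fun a' => ⟨⟨β a' * (a' : D.GtpTheta)⁻¹, hβ a' a'.2⟩, by rw [inv_mul_cancel_right]⟩
  have hν_T : T ν = ν := by
    rw [hT, h1TopAut_apply]
    exact ContH1Aut.autMap_eq_self_of_coeffChange_eq_one (phi C) (D.lDeltaTheta_le l) α β hφ hA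
      (symm_mem_inf_top (PiYdd C) α hH) hβ' _ hν_cc
  -- `T (T η) = conj δ η`, and `T` is `α`-equivariant for the conjugation action
  have hTT : T (T η) = ContH1.conj (phi C) (D.lDeltaTheta l) δ η := by
    rw [hT]
    exact h1TopAut_h1TopAut_eq_conj C α β hφ hA hH δ hαα η
  have hTconj : ∀ (σ : Pi C) (x : ContH1 (phi C) (D.lDeltaTheta l) (PiYdd C ⊓ ⊤)),
      T (ContH1.conj (phi C) (D.lDeltaTheta l) σ x) = ContH1.conj (phi C) (D.lDeltaTheta l) (α σ) (T x) := by
    intro σ x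
    rw [hT, h1TopAut_apply]
    exact ContH1Aut.autMap_conj (phi C) (D.lDeltaTheta l) α β hφ hA _ σ x
  have key : ContH1.conj (phi C) (D.lDeltaTheta l) δ η =
      ContH1.conj (phi C) (D.lDeltaTheta l) (α τ₀ * τ₀) η * ν ^ 2 := by
    rw [← hTT]
    calc T (T η) = T (ContH1.conj (phi C) (D.lDeltaTheta l) τ₀ η * ν) := by rw [← hTη]
      _ = ContH1.conj (phi C) (D.lDeltaTheta l) (α τ₀) (T η) * ν := by rw [map_mul, hν_T, hTconj]
      _ = ContH1.conj (phi C) (D.lDeltaTheta l) (α τ₀) (ContH1.conj (phi C) (D.lDeltaTheta l) τ₀ η) *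
            ContH1.conj (phi C) (D.lDeltaTheta l) (α τ₀) ν * ν := by rw [hTη, map_mul]
      _ = ContH1.conj (phi C) (D.lDeltaTheta l) (α τ₀ * τ₀) η * ν ^ 2 := by
          rw [hν_conj, ← ContH1.conj_mul_apply, mul_assoc, pow_two]
  -- `w := ((α τ₀) τ₀)⁻¹ δ` moves `η` by `ν²`
  have hw : ContH1.conj (phi C) (D.lDeltaTheta l) ((α τ₀ * τ₀)⁻¹ * δ) η = η * ν ^ 2 := by
    rw [ContH1.conj_mul_apply, key, map_mul, ContH1.conj_inv_conj_apply, map_pow, hν_conj]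
  -- decompose `w = γⁿ·y`, `y ∈ Π^tp_Y̲̲`
  obtain ⟨n, y, hyY, hwy⟩ := exists_eq_zpow_mul_of_toLZ C γ hγ ((α τ₀ * τ₀)⁻¹ * δ)
  obtain ⟨t, ht2, hty⟩ := exists_sq_eq_one_conj_rootLiftClass_of_mem_GtpY C hS ε hε₁ hε₂ hsign y hyY
  rw [← hη] at hty
  rw [hwy, ContH1.conj_mul_apply, hty, map_mul] at hw
  -- hw : conj γⁿ η * conj γⁿ t = η * ν²  ⇒  the translate `conj γⁿ η · η⁻¹` is torsion  ⇒  n = 0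
  have hn : n = 0 := by
    by_contra hne
    apply hfreeK n hne
    have e : ContH1.conj (phi C) (D.lDeltaTheta l) (γ ^ n) η * η⁻¹ =
        ν ^ 2 * (ContH1.conj (phi C) (D.lDeltaTheta l) (γ ^ n) t)⁻¹ := by
      rw [eq_mul_inv_iff_mul_eq, mul_right_comm, hw, mul_comm η, mul_inv_cancel_right]
    rw [e]
    refine IsOfFinOrder.mul ?_ ?_
    · exact isOfFinOrder_iff_pow_eq_one.mpr ⟨l, Nat.pos_of_ne_zero C.l_ne_zero, by
        rw [← pow_mul, mul_comm, pow_mul, hν_l, one_pow]⟩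
    · exact ((ContH1.conj (phi C) (D.lDeltaTheta l) (γ ^ n)).isOfFinOrder
        (isOfFinOrder_iff_pow_eq_one.mpr ⟨2, two_pos, ht2⟩)).inv
  subst hn
  rw [zpow_zero, ContH1.conj_one_apply, ContH1.conj_one_apply] at hw
  -- hw : η * t = η * ν²  ⇒  ν² = t  ⇒  ν⁴ = 1; with ν^l = 1 and l odd, ν = 1
  have hν2 : ν ^ 2 = t := (mul_left_cancel hw).symm
  have hν4 : ν ^ 4 = 1 := by
    rw [show (4 : ℕ) = 2 * 2 from rfl, pow_mul, hν2, ht2]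
  have hν1 : ν = 1 := eq_one_of_pow_four_of_pow_odd C.l_odd hν4 hν_l
  rw [hTη, hν1, mul_one]

end Pair

end EtaleThetaDataOfSetting

end

end Literature.IUT.HodgeArakelov
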